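import Literature.MathematicalPhysics.QuantumFieldTheory.Balaban1983to89.Node00.TorusCoverLandau153TwoWindow
import Literature.MathematicalPhysics.QuantumFieldTheory.Balaban1983to89.Node00.TorusCoverLandau153Tower

/-!
# NODE 00 — THE (152)+(153) PUSH-DOWN ON THE WHOLE (1.131) TOWER: generation 2's two-window push-down `exists_localGauge152_153_window₂_of_gaugedBoundB8` RE-RUN with this
# seat's tower extraction (`exists_suGauge_letters152_tower_of_gaugedBoundB8`, FILE 3c′) — the gauge equation `U^u = e^{iη_nA}` on a step-closed window `X ⊆ □₀` (not only
# `⊆ □`), [15] (152)'s LEVEL-WEIGHTED letters `‖A‖ ≤ 2r·(Lʲη_n)⁻¹` on the bonds of `X ∩ □_j`, the four top-box letters on a step-closed sub-window `X_t ⊆ □`, the (153)-gauged lift on `X′`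

Cell `pub-ymgap`, width seat `pub-ymgap-dag-n07-w3` generation 7 (sub-target S3 = [15] (145)–(156) at objects; CLAIM-6 ∕ INTENT-6, cell INBOX 2026-08-28).  NEW leaf; CONSUMED BY
NAME, nothing modified: generation 2's `Node00.TorusCoverLandau153TwoWindow` (proof pattern; helpers `codiffCurlA_cover_eq_pdiv_of_window`, `lap_cover_eq_covLap_of_window`, `cover_add_e`,
`cover_sub_e`, `cfgExp_eq_expI`, `zdLift_apply`, `zdLift_mem_specialUnitaryUnits` from the lineage's imports), this seat's FILE 3c′ `Node00.TorusCoverLandau153Tower`.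
`--kind proof --supports stmt-QuantumFields-27364` (K1⁹; count-neutral helper).  [15] = [Balaban1985Variational]; [6] = [Balaban1985RegularSpaces]; [I] = [Balaban1987RG1].

WHY (LOCATED-LANDAU-REGION, dag-n07-w8 g6; the lift of LOCATED-SU-NORMALISATION-BELOW-TOP, this seat, FILES 3a′∕3b′∕3c′).  Every torus door of this lineage concludes on the
window `π(□)` = the top box because generation 2's push-down carries `hbox : X ⊆ box` (its letters come from g0's top-box extraction).  FILE 3c′ extracts ONE `SU(N)` gauge on the
whole tower `□₀ = c.sq 0` with the gauge equation on every bond of `□₀` and the level-weighted letters of [6] (1.136) ∕ [15] (152) «on `Ω′_j`»; THIS FILE pushes it down: for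
windows `X_t ⊆ X ⊆ X′` with `X ⊆ □₀` forward-step-closed, `X_t ⊆ □` step-closed, `π` injective on `X′`, ONE torus gauge `u` and ONE potential `A` with (1) the gauge equation on
the bonds of `regionOfSet (π(X))`, (2) `∀ j ≤ k`, `‖A ⟨π x, μ⟩‖ ≤ 2·(r·(Lʲη_n)⁻¹)` for `x, x + e_μ ∈ X ∩ □_j`, (3)–(6) the four top letters `≤ 2r` on `π(X_t)` exactly as before,
(7) the lift `A′` with `A ⟨π x, μ⟩ = A′ x μ` on `X′` in the (153) gauge `IsLandau138 … □₀ … A′`.  The window hypothesis is FILE 3c′'s per-bond `4·(N·r) < 2π` — no width.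
The instance `X := □₀`, `X_t := □`, `X′ := □̃` (non-wrapping of `□̃`) is the tower door of the S3 lane (next file: its step-closure from `B8Eq131Cubes.collar_cube`).

WHAT IS PROVED (kernel; no definition).  ★★★ `exists_localGauge152_tower_window_of_gaugedBoundB8`.
HONEST FRAMING: count-neutral push-down bookkeeping; [6] Prop. 6's conclusion at N05's member (`GaugedBoundB8`) is the HYPOTHESIS `hG`, never proved here; the windows'
step-closure and non-wrapping are DISPLAYED; NOTHING of [15]∕[6] analysis asserted; no token ∕ stub ∕ K-item closed; N07 ∕ N05 NOT discharged; counts unmoved; one finite 𝕋⁴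
programme at fixed ε — R4 closes the conditional finite-𝕋⁴ rung `BalabanLadder.UV` only; the YM mass gap (Clay) is NOT proved by any of this; nothing continuum ∕ ℝ⁴ ∕ OS.
No `sorry`, no `def`, no `instance`, no `notation`.

References: [Balaban1985Variational] (144)–(153) pp.300–301; [Balaban1985RegularSpaces] Prop. 6 (1.135)–(1.138) p.99, (1.131) p.99, (1.38) p.82; [Balaban1987RG1] (0.1) p.251.
-/

noncomputable section

namespace Literature.MathematicalPhysics.QuantumFieldTheory.Balaban1983to89.Node00

open scoped Matrix.Norms.L2Operator
open Complex (I)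
open B7Prop1Explicit (e e_apply)
open B7Prop1Local (InBox)
open B7Prop2Explicit (unitaryUnits mem_unitaryUnits)
open B7Prop2SpecialUnitary (specialUnitaryUnits mem_specialUnitaryUnits)
open B8Ineq132 (InAk)
open B8Eq131Cubes (box tcube bLo bHi)
open B8Eq184Proof (cfgExp)
open B8Eq146AExpansion (plaqCovDeriv)
open B8Eq143PlaqExpansion (pdiv)
open B8Eq138LandauZd (covLap IsLandau138)
open B15Eq112TorusCover (cover)
open B14DomainGeom (Pt)
open B14.Eq213MaximalDomains (side cubeExt)
open B12RegularSpaces111 (gaugeU expI grad)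

variable {P : Params} {N : ℕ} [NeZero N]

section TowerWindow

/-- ★★★ **THE (152)+(153) PUSH-DOWN ON THE WHOLE TOWER** (statement in the module docstring): generation 2's two-window push-down with FILE 3c′'s tower extraction —
the gauge equation on `π(X)` for a forward-step-closed `X ⊆ □₀`, the level-weighted letters `‖A‖ ≤ 2·(r·(Lʲη_n)⁻¹)` on the bonds of `X ∩ □_j` (`j ≤ k`), the four top letters on a
step-closed `X_t ⊆ □ ∩ X`, and the (153)-gauged lift on `X′ ⊇ X` (cover-injective); window `4·(N·r) < 2π` (per bond, no width).
[cite: Balaban1985Variational, (144)–(153) pp.300–301; Balaban1985RegularSpaces, Prop. 6 (1.135)–(1.138) p.99, (1.131) p.99, (1.38) p.82; Balaban1987RG1, (0.1) p.251] -/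
theorem exists_localGauge152_tower_window_of_gaugedBoundB8 (hd : 2 ≤ P.d) {K' : ℕ} {Ω' : ℕ → Set (B7Prop1Explicit.Site P.d)} (c : CubeB8 P.d P.L K' Ω')
    (U : GaugeField P 0 (SU N)) {n : ℕ} (hk : c.k = n) {r : ℝ} (hr : 0 ≤ r)
    (hG : letI : CStarAlgebra (MatA N) := {}; GaugedBoundB8 P.L (P.eta n) (zdLift N U) c r)
    {X Xt X' : Set (Pt P.d)} (hXX' : X ⊆ X') (hXt : Xt ⊆ X) (hinj' : Set.InjOn (cover P) X')
    (hfwd : ∀ ⦃x⦄, x ∈ X → ∀ μ, (cover P x).shift μ ∈ cover P '' X → x + e μ ∈ X)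
    (hfwdt : ∀ ⦃x⦄, x ∈ Xt → ∀ μ, (cover P x).shift μ ∈ cover P '' Xt → x + e μ ∈ Xt)
    (hbwdt : ∀ ⦃x⦄, x ∈ Xt → ∀ ν, (cover P x).unshift ν ∈ cover P '' Xt → x - e ν ∈ Xt)
    (hsq : X ⊆ c.sq 0) (hbox : Xt ⊆ box P.L c.a c.M c.k)
    (h4 : 4 * ((N : ℝ) * r) < 2 * Real.pi) :
    ∃ u : GaugeTransf P 0 (SU N), ∃ A : PBond P 0 → MatA N,
      (∀ b ∈ (Sect2.regionOfSet P (cover P '' X)).bonds, gaugeU (fun x => ιSU N (u x)) (fun b' => ιSU N (U b')) b = expI (P.eta n) (A b)) ∧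
      (∀ j, j ≤ c.k → ∀ (x : Pt P.d) (μ : Fin P.d), x ∈ X → x + e μ ∈ X → x ∈ c.sq j → x + e μ ∈ c.sq j →
          ‖A ⟨cover P x, μ⟩‖ ≤ 2 * (r * ((P.L : ℝ) ^ j * P.eta n)⁻¹)) ∧
      (∀ b ∈ (Sect2.regionOfSet P (cover P '' Xt)).bonds, ‖A b‖ ≤ 2 * r) ∧
      (∀ q ∈ (Sect2.regionOfSet P (cover P '' Xt)).dpairs, ‖grad (P.eta n) q.2.1 (fun y => A ⟨y, q.2.2⟩) q.1‖ ≤ 2 * r) ∧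
      (∀ b ∈ Sect2.bondsDeep (cover P '' Xt), ‖Sect2.codiffCurlA (P.eta n) A b.src b.dir‖ ≤ 2 * r) ∧
      (∀ b ∈ Sect2.bondsDeep (cover P '' Xt),
          ‖∑ ν : Fin P.d, ((P.eta n : ℝ) : ℂ)⁻¹ •
              (grad (P.eta n) ν (fun y => A ⟨y, b.dir⟩) (b.src.unshift ν) - grad (P.eta n) ν (fun y => A ⟨y, b.dir⟩) b.src)‖ ≤ 2 * r) ∧
      ∃ A' : B7Prop1Explicit.Site P.d → Fin P.d → MatA N,
        (∀ x, x ∈ X' → ∀ μ, A ⟨cover P x, μ⟩ = A' x μ) ∧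
        IsLandau138 P.L c.k (P.eta n) (c.sq 0) c.lamS (1 : B7Prop1Explicit.Site P.d → Fin P.d → (MatA N)ˣ) A' := by
  classical
  letI : CStarAlgebra (MatA N) := {}
  have hL : 2 ≤ P.L := P.hL.2
  have hηpos : 0 < P.eta n := B3GkZeroTorusRescaled.eta_pos P n
  set V := zdLift N U with hV
  obtain ⟨s, A', h1, hlev, h2, h3, h4c, h4', h5⟩ :=
    exists_suGauge_letters152_tower_of_gaugedBoundB8 hd hL c V (zdLift_mem_specialUnitaryUnits U) hηpos hr hG h4
  have hscale : (P.L : ℝ) ^ c.k * P.eta n = 1 := by rw [hk]; exact B12Eq115BackgroundPair.pow_mul_eta P n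
  simp only [hscale, inv_one, mul_one, one_pow] at h2 h3 h4c h4'
  have hinjt : Set.InjOn (cover P) Xt := hinj'.mono (hXt.trans hXX')
  -- push-down through the cover, injective on the LARGE window `X′`
  let u : GaugeTransf P 0 (SU N) := fun y =>
    if h : ∃ x, x ∈ X' ∧ cover P x = y then s (Classical.choose h) else 1
  let A : PBond P 0 → MatA N := fun b =>
    if h : ∃ x, x ∈ X' ∧ cover P x = b.src then A' (Classical.choose h) b.dir else 0
  have hu : ∀ x, x ∈ X' → u (cover P x) = s x := by
    intro x hx
    have hex : ∃ x', x' ∈ X' ∧ cover P x' = cover P x := ⟨x, hx, rfl⟩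
    simp only [u, dif_pos hex]
    rw [hinj' (Classical.choose_spec hex).1 hx (Classical.choose_spec hex).2]
  have hA : ∀ x, x ∈ X' → ∀ μ, A ⟨cover P x, μ⟩ = A' x μ := by
    intro x hx μ
    have hex : ∃ x', x' ∈ X' ∧ cover P x' = cover P x := ⟨x, hx, rfl⟩
    simp only [A, dif_pos hex]
    rw [hinj' (Classical.choose_spec hex).1 hx (Classical.choose_spec hex).2]
  have hlift : ∀ y, y ∈ cover P '' X → ∃ x, x ∈ X ∧ cover P x = y := fun y ⟨x, hx, hxy⟩ => ⟨x, hx, hxy⟩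
  have hliftt : ∀ y, y ∈ cover P '' Xt → ∃ x, x ∈ Xt ∧ cover P x = y := fun y ⟨x, hx, hxy⟩ => ⟨x, hx, hxy⟩
  have hXtX' : Xt ⊆ X' := hXt.trans hXX'
  refine ⟨u, A, fun b hb => ?_, fun j hj x μ hx hx' hxj hxj' => ?_, fun b hb => ?_, fun q hq => ?_, fun b hb => ?_, fun b hb => ?_, A', hA, h5⟩
  · obtain ⟨x, hx, hxs⟩ := hlift b.src hb.1
    have hx' : x + e b.dir ∈ X := hfwd hx b.dir (by rw [hxs]; exact hb.2)
    have hb' : b = ⟨cover P x, b.dir⟩ := by cases b; simp only at hxs; rw [hxs]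
    rw [hb', hA x (hXX' hx)]
    have hgauge := h1 x b.dir (hsq hx) (hsq hx')
    rw [cfgExp_eq_expI] at hgauge
    rw [← hgauge]
    simp only [gaugeU, B7Prop1Explicit.gaugeAct, PBond.tgt, ← cover_add_e, hu x (hXX' hx), hu (x + e b.dir) (hXX' hx'), hV, zdLift_apply]
  · rw [hA x (hXX' hx)]
    exact hlev j hj x μ hxj hxj'
  · obtain ⟨x, hx, hxs⟩ := hliftt b.src hb.1
    have hx' : x + e b.dir ∈ Xt := hfwdt hx b.dir (by rw [hxs]; exact hb.2)
    have hb' : b = ⟨cover P x, b.dir⟩ := by cases b; simp only at hxs; rw [hxs]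
    rw [hb', hA x (hXtX' hx)]
    exact h2 x b.dir (hbox hx) (hbox hx')
  · obtain ⟨hq1, hq2, hq3, -⟩ := hq
    obtain ⟨x, hx, hxs⟩ := hliftt q.1 hq1
    have hxμ : x + e q.2.1 ∈ Xt := hfwdt hx q.2.1 (by rw [hxs]; exact hq2)
    have hxν : x + e q.2.2 ∈ Xt := hfwdt hx q.2.2 (by rw [hxs]; exact hq3)
    rw [grad, ← hxs, ← cover_add_e, hA x (hXtX' hx), hA (x + e q.2.1) (hXtX' hxμ), norm_smul, norm_inv, Complex.norm_real, Real.norm_eq_abs,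
      abs_of_pos hηpos]
    calc (P.eta n)⁻¹ * ‖A' (x + e q.2.1) q.2.2 - A' x q.2.2‖ ≤ (P.eta n)⁻¹ * (2 * (P.eta n * r)) :=
          mul_le_mul_of_nonneg_left (h3 x q.2.1 q.2.2 (hbox hx) (hbox hxμ) (hbox hxν)) (inv_nonneg.2 hηpos.le)
      _ = 2 * r := by field_simp
  · obtain ⟨hb1, hb2, hbν⟩ := hb
    obtain ⟨x, hx, hxs⟩ := hliftt b.src hb1
    have hxμ : x + e b.dir ∈ Xt := hfwdt hx b.dir (by rw [hxs]; exact hb2)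
    have hstencil : ∀ ν, x + e ν ∈ Xt ∧ x - e ν ∈ Xt ∧ x - e ν + e b.dir ∈ Xt := by
      intro ν
      obtain ⟨s1, s2, s3, s4⟩ := hbν ν
      have hxν : x + e ν ∈ Xt := hfwdt hx ν (by rw [hxs]; exact s1)
      have hxν' : x - e ν ∈ Xt := hbwdt hx ν (by rw [hxs]; exact s2)
      have hxν'' : x - e ν + e b.dir ∈ Xt :=
        hfwdt hxν' b.dir (by
          rw [cover_sub_e, hxs, ← Site.unshift_shift_comm]
          exact s4)
      exact ⟨hxν, hxν', hxν''⟩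
    have hb' : b = ⟨cover P x, b.dir⟩ := by cases b; simp only at hxs; rw [hxs]
    rw [hb']
    show ‖Sect2.codiffCurlA (P.eta n) A (cover P x) b.dir‖ ≤ 2 * r
    have hAX : ∀ z, z ∈ Xt → ∀ κ, A ⟨cover P z, κ⟩ = A' z κ := fun z hz => hA z (hXtX' hz)
    rw [codiffCurlA_cover_eq_pdiv_of_window (P.eta n) hAX hx hxμ hstencil]
    exact h4c x b.dir (hbox hx) (hbox hxμ) fun ν => ⟨hbox (hstencil ν).1, hbox (hstencil ν).2.1, hbox (hstencil ν).2.2⟩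
  · obtain ⟨hb1, hb2, hbν⟩ := hb
    obtain ⟨x, hx, hxs⟩ := hliftt b.src hb1
    have hxμ : x + e b.dir ∈ Xt := hfwdt hx b.dir (by rw [hxs]; exact hb2)
    have hstencil : ∀ ν, x + e ν ∈ Xt ∧ x - e ν ∈ Xt := by
      intro ν
      obtain ⟨s1, s2, -, -⟩ := hbν ν
      exact ⟨hfwdt hx ν (by rw [hxs]; exact s1), hbwdt hx ν (by rw [hxs]; exact s2)⟩
    have hb' : b = ⟨cover P x, b.dir⟩ := by cases b; simp only at hxs; rw [hxs]
    rw [hb']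
    show ‖∑ ν : Fin P.d, ((P.eta n : ℝ) : ℂ)⁻¹ •
        (grad (P.eta n) ν (fun y => A ⟨y, b.dir⟩) ((cover P x).unshift ν) - grad (P.eta n) ν (fun y => A ⟨y, b.dir⟩) (cover P x))‖ ≤ 2 * r
    have hAX : ∀ z, z ∈ Xt → ∀ κ, A ⟨cover P z, κ⟩ = A' z κ := fun z hz => hA z (hXtX' hz)
    rw [lap_cover_eq_covLap_of_window (P.eta n) hAX hx hstencil]
    exact h4' x b.dir (hbox hx) (hbox hxμ) fun ν => ⟨hbox (hstencil ν).1, hbox (hstencil ν).2⟩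

end TowerWindow

end Literature.MathematicalPhysics.QuantumFieldTheory.Balaban1983to89.Node00

end
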